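import Summits.CriticalPhenomena.SAWScalingLimit.Theses.SAWRenewalTightness
import Summits.CriticalPhenomena.SAWScalingLimit.Theorems.SAWRenewalTightnessTightOfShellCrossing
import Summits.CriticalPhenomena.SAWScalingLimit.Theorems.SAWRenewalTightnessShellCrossingBoundOfPinchAway
import Summits.CriticalPhenomena.SAWScalingLimit.Theorems.SAWRenewalTightnessShellCrossingBoundSplit
import Summits.CriticalPhenomena.SAWScalingLimit.Theorems.SAWRenewalTightnessEventualTightOfBoundedVirginArc
import Summits.CriticalPhenomena.SAWScalingLimit.Theorems.SAWRenewalTightnessEventualTightOfBoundaryBulk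
import Literature.Probability.RandomPlanarGeometry.CurvePinch
import HarnessLib

/-!
# `EventualTight` (stmt-CriticalPhenomena-1372) from BOUNDARY REPULSION and bulk tightness — the E-free boundary half

Supporting file of the line `Cruxes/EventualTight/Lines/boundary_repulsion.lean` (crux-strategist s4, 2026-08-17), landed
sorry-free so that the composition is importable.  Nothing research-grade is asserted: every theorem takes boundary repulsion
BR and/or bulk tightness as HYPOTHESES.

* **BR (boundary repulsion; hypothesis `hBR`).**  For every Dobrushin domain `D` with an endpoint approximation, every socket
  radius `d > 0` and `ε > 0` there are a collar width `s > 0` and a mesh threshold `δ₁` such that for `δ ≤ δ₁` the critical SAW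
  polyline of `D_δ` from `a_δ` to `b_δ` has, with probability `≥ 1 − ε`, NO point that is `≥ d` from both marked points and within
  `s` of `Dᶜ`.  (Summit-consistent: chordal SLE₈⸝₃ meets `∂D` only at its endpoints; the collar event depends on the range only.)
* **Bulk tightness (hypothesis `hB`)** = item stmt-CriticalPhenomena-17588 `SAWRenewalTightness.BulkShellTight` verbatim.

Results: `perShellDecay_of_boundaryRepulsion_of_bulkShellTight` (rate-free per-shell decay at EVERY shell of `D`: good middle
circle, collar width from BR, circle net and net pigeonhole `exists_netPoint_hasTraversals`; at a net point whose `2R'`-ball lies in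
`D` bulk tightness IN `D` ITSELF, at any other net point a traversing strand visits the `s`-collar off the sockets — no enlargement of
the domain, no restriction covariance), `shellCrossingBound_of_boundaryRepulsion_of_bulkShellTight` (AB dress,
`shellCrossing_of_perShellDecay`), `eventualTight_of_boundaryRepulsion_of_bulkShellTight` (the crux, via `TightOfShellCrossing_proof`),
`eventualTight_of_boundaryRepulsion_of_virginArcTraversalTightBounded` (bulk from X2c₁ᵇ = stmt-18042 through
`bulkShellTight_of_virginArcTraversalTightBounded`), and `boundaryShellTight_of_boundaryRepulsion_of_bulkShellTight` (BR ∧ bulk give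
the exact boundary residual `TPToTraversalBound.Radial.BoundaryShellTight` = item stmt-CriticalPhenomena-19311 of the sibling line
`boundary_bulk`, `…EventualTightOfBoundaryBulk.lean`).
[cite: AizenmanBurchardDuke1999, §1.b, Thms 1.1-1.2 and Lemma 3.1] [cite: LawlerSchrammWerner2004SAW, §3]
-/

noncomputable section
open MeasureTheory Set Metric Filter Topology
open scoped unitInterval ENNReal Real
open Literature.Probability.RandomPlanarGeometry Literature.Probability.LatticeModels

namespace Summit.CriticalPhenomena.SAWScalingLimit.Theorems

/-! ### The glue: per-shell decay in `D` from BR and bulk tightness in `D` itself -/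

/-- **Per-shell decay from boundary repulsion and bulk tightness (the E-free boundary half).**  For every shell
`D(x; ρ, R)` and `ε > 0` there are a threshold `k` and a mesh threshold below which the critical SAW of `D_δ`
makes `k` separate traversals of the shell with probability `≤ ε`.  Proof: good middle circle, collar width from
BR, circle net, net pigeonhole; at a net point whose `2R'`-ball is inside `D` use bulk tightness in `D`, at any
other net point a traversing strand visits the `s`-collar away from the sockets. [cite: AizenmanBurchardDuke1999, §1.b] -/
theorem perShellDecay_of_boundaryRepulsion_of_bulkShellTight
    (hBR : ∀ (D : DobrushinDomain) (a b : ℝ → Site 2), SAW.IsEndpointApprox D a b →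
      ∀ d : ℝ, 0 < d → ∀ ε : ℝ, 0 < ε → ∃ (s δ₁ : ℝ), 0 < s ∧ 0 < δ₁ ∧ ∀ δ ∈ Set.Ioc (0 : ℝ) δ₁,
        SAW.law D.carrier δ (a δ) (b δ)
          {γ | ∃ t : I, d ≤ dist ((⟨γ.walk.toCurve (meshPoint δ)⟩ : Curve ℂ) t) (D.pt 0) ∧
                d ≤ dist ((⟨γ.walk.toCurve (meshPoint δ)⟩ : Curve ℂ) t) (D.pt 1) ∧
                Metric.infDist ((⟨γ.walk.toCurve (meshPoint δ)⟩ : Curve ℂ) t) D.carrierᶜ ≤ s} ≤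
          ENNReal.ofReal ε)
    (hB : ∀ (D : DobrushinDomain) (a b : ℝ → Site 2), SAW.IsEndpointApprox D a b →
      ∀ (y : ℂ) (η R : ℝ), 0 < η → η < R → Metric.closedBall y (2 * R) ⊆ D.carrier →
        ∀ ε : ℝ, 0 < ε → ∃ (j : ℕ) (δ₁ : ℝ), 0 < δ₁ ∧ ∀ δ ∈ Set.Ioc (0 : ℝ) δ₁,
          SAW.law D.carrier δ (a δ) (b δ)
            {γ | (⟨γ.walk.toCurve (meshPoint δ)⟩ : Curve ℂ).HasTraversals j y η R} ≤ ENNReal.ofReal ε)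
    (D : DobrushinDomain) (a b : ℝ → Site 2) (hab : SAW.IsEndpointApprox D a b) :
    ∀ (x : ℂ) (ρ R : ℝ), 0 < ρ → ρ < R → ∀ ε : ℝ, 0 < ε → ∃ (k : ℕ) (δ₁ : ℝ), 0 < δ₁ ∧
      ∀ δ ∈ Set.Ioc (0 : ℝ) δ₁,
        SAW.law D.carrier δ (a δ) (b δ)
          {γ | (⟨γ.walk.toCurve (meshPoint δ)⟩ : Curve ℂ).HasTraversals k x ρ R} ≤ ENNReal.ofReal ε := by
  intro x ρ R hρ hρR ε hε
  classical
  /- (1) a good middle radius and its sub-shell -/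
  obtain ⟨m, hm1, hm2, hfa, hfb⟩ := exists_good_mid hρR (dist (D.pt 0) x) (dist (D.pt 1) x)
  set w : ℝ := (R - ρ) / 3 with hw_def
  have hw : 0 < w := by rw [hw_def]; linarith
  have h6 : (R - ρ) / 6 = w / 2 := by rw [hw_def]; ring
  have hρm : ρ + w / 2 ≤ m := by linarith
  have hmR : m + w / 2 ≤ R := by linarith
  have hmpos : 0 < m := by linarith
  set ρ₁ : ℝ := m - w / 2 with hρ₁_def
  set R₁ : ℝ := m + w / 2 with hR₁_def
  have hρρ₁ : ρ ≤ ρ₁ := by rw [hρ₁_def]; linarith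
  have hR₁R : R₁ ≤ R := by rw [hR₁_def]; linarith
  have hρ₁m : ρ₁ < m := by rw [hρ₁_def]; linarith
  have hmR₁ : m < R₁ := by rw [hR₁_def]; linarith
  /- (2) socket radius `d = w/8 = (R - ρ)/24` and the collar width from boundary repulsion at `(d, ε/2)` -/
  set d : ℝ := w / 8 with hd_def
  have hd : 0 < d := by positivity
  have h2d : 2 * d = (R - ρ) / 12 := by rw [hd_def, hw_def]; ring
  obtain ⟨s, δB, hs, hδB, hcollar⟩ := hBR D a b hab d hd (ε / 2) (by positivity)
  /- (3) radii of the small shells, resolution and size of the net -/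
  set R' : ℝ := min (w / 4) (s / 4) with hR'_def
  have hR' : 0 < R' := lt_min (by positivity) (by positivity)
  have hR'w : R' ≤ w / 4 := min_le_left _ _
  have hR's : R' ≤ s / 4 := min_le_right _ _
  set η₀ : ℝ := min R' d / 2 with hη₀_def
  have hmin : 0 < min R' d := lt_min hR' hd
  have hη₀ : 0 < η₀ := by rw [hη₀_def]; positivity
  have hη₀R' : η₀ < R' := by
    have := min_le_left R' d
    rw [hη₀_def]; linarith
  have hη₀d : η₀ < d := by
    have := min_le_right R' d
    rw [hη₀_def]; linarith
  set M : ℕ := ⌈2 * π * m / η₀⌉₊ + 1 with hM_def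
  have hM1 : 1 ≤ M := by omega
  have hMpos : (0 : ℝ) < M := by exact_mod_cast (show 0 < M by omega)
  have hMgt : 2 * π * m / η₀ < M := by
    have h1 := Nat.le_ceil (2 * π * m / η₀)
    have h2 : (M : ℝ) = (⌈2 * π * m / η₀⌉₊ : ℝ) + 1 := by rw [hM_def]; push_cast; ring
    rw [h2]
    linarith
  set η : ℝ := 2 * π * m / M with hη_def
  have hη : 0 < η := by rw [hη_def]; positivity
  have hηη₀ : η < η₀ := by
    rw [hη_def, div_lt_iff₀ hMpos]
    have h1 := (div_lt_iff₀ hη₀).1 hMgt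
    linarith [mul_comm (M : ℝ) η₀]
  have hηR' : η < R' := hηη₀.trans hη₀R'
  have hηd : η ≤ d := (hηη₀.trans hη₀d).le
  have hηs : η + 2 * R' ≤ s := by linarith
  -- the net points
  let N : ℕ → ℂ := fun i => x + (m : ℂ) * Complex.exp (((-π + 2 * π * i / M : ℝ) : ℂ) * Complex.I)
  have hNdist : ∀ i, dist (N i) x = m := fun i => by
    show dist (x + (m : ℂ) * Complex.exp (((-π + 2 * π * i / M : ℝ) : ℂ) * Complex.I)) x = m
    rw [dist_eq_norm, add_sub_cancel_left, norm_mul, Complex.norm_real, Real.norm_eq_abs,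
      abs_of_nonneg hmpos.le, Complex.norm_exp_ofReal_mul_I, mul_one]
  -- the net points are `2d = (R - ρ)/12` away from the marked points
  have hfar : ∀ (p : ℂ) (i : ℕ), (R - ρ) / 12 ≤ |dist p x - m| → 2 * d ≤ dist (N i) p := by
    intro p i hp
    have h1 := abs_dist_sub_le p (N i) x
    rw [hNdist i] at h1
    rw [dist_comm, h2d]
    linarith
  /- (4) the bound at each net point whose `2R'`-ball is inside `D`: bulk tightness in `D` itself -/
  set ε' : ℝ := ε / (2 * M) with hε'_def
  have hε' : 0 < ε' := by rw [hε'_def]; positivity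
  have key : ∀ i : Fin M, ∃ (j : ℕ) (δi : ℝ), 0 < δi ∧ ∀ δ ∈ Set.Ioc (0 : ℝ) δi,
      SAW.law D.carrier δ (a δ) (b δ)
        {γ | closedBall (N i) (2 * R') ⊆ D.carrier ∧
          (⟨γ.walk.toCurve (meshPoint δ)⟩ : Curve ℂ).HasTraversals j (N i) η R'} ≤
        ENNReal.ofReal ε' := by
    intro i
    by_cases hball : closedBall (N i) (2 * R') ⊆ D.carrier
    · obtain ⟨j, δF, hδF, hbig⟩ := hB D a b hab (N i) η R' hη hηR' hball ε' hε'
      exact ⟨j, δF, hδF, fun δ hδ => le_trans (measure_mono fun γ hγ => hγ.2) (hbig δ hδ)⟩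
    · refine ⟨0, 1, one_pos, fun δ hδ => ?_⟩
      have hempty : {γ : SAW.DomainSAW D.carrier δ (a δ) (b δ) |
          closedBall (N i) (2 * R') ⊆ D.carrier ∧
            (⟨γ.walk.toCurve (meshPoint δ)⟩ : Curve ℂ).HasTraversals 0 (N i) η R'} = ∅ :=
        Set.eq_empty_iff_forall_notMem.2 fun γ hγ => hball hγ.1
      rw [hempty, measure_empty]
      exact bot_le
  choose j δi hδi hbound using key
  /- (5) thresholds, net pigeonhole, the collar alternative and the union bound -/
  haveI : NeZero M := ⟨by omega⟩
  set J : ℕ := Finset.univ.sup j with hJ_def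
  have hjJ : ∀ i, j i ≤ J := fun i => Finset.le_sup (f := j) (Finset.mem_univ i)
  set δ₁ : ℝ := min δB (Finset.univ.inf' Finset.univ_nonempty δi) with hδ₁_def
  have hδ₁ : 0 < δ₁ := lt_min hδB ((Finset.lt_inf'_iff _).2 fun i _ => hδi i)
  have hδ₁B : δ₁ ≤ δB := min_le_left _ _
  have hδ₁le : ∀ i, δ₁ ≤ δi i := fun i =>
    (min_le_right _ _).trans (Finset.inf'_le _ (Finset.mem_univ i))
  refine ⟨M * J + 1, δ₁, hδ₁, fun δ hδ => ?_⟩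
  -- the event inclusion: collar visit, or many traversals of a small interior shell
  have hsubev : {γ : SAW.DomainSAW D.carrier δ (a δ) (b δ) |
        (⟨γ.walk.toCurve (meshPoint δ)⟩ : Curve ℂ).HasTraversals (M * J + 1) x ρ R} ⊆
      {γ | ∃ t : I, d ≤ dist ((⟨γ.walk.toCurve (meshPoint δ)⟩ : Curve ℂ) t) (D.pt 0) ∧
          d ≤ dist ((⟨γ.walk.toCurve (meshPoint δ)⟩ : Curve ℂ) t) (D.pt 1) ∧
          Metric.infDist ((⟨γ.walk.toCurve (meshPoint δ)⟩ : Curve ℂ) t) D.carrierᶜ ≤ s} ∪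
      ⋃ i : Fin M, {γ | closedBall (N i) (2 * R') ⊆ D.carrier ∧
          (⟨γ.walk.toCurve (meshPoint δ)⟩ : Curve ℂ).HasTraversals (j i) (N i) η R'} := by
    intro γ hγ
    have h1 : (⟨γ.walk.toCurve (meshPoint δ)⟩ : Curve ℂ).HasTraversals (M * J + 1) x ρ₁ R₁ :=
      Curve.HasTraversals.mono' hγ hρρ₁ hR₁R
    have hin : R' ≤ m - ρ₁ := by rw [hρ₁_def]; linarith
    have hout : R' ≤ R₁ - m := by rw [hR₁_def]; linarith
    obtain ⟨i, hiM, htrav⟩ := exists_netPoint_hasTraversals hρ₁m hmR₁ hmpos hin hout hM1 h1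
    by_cases hgood : closedBall (N i) (2 * R') ⊆ D.carrier
    · refine Or.inr (Set.mem_iUnion.2 ⟨⟨i, hiM⟩, hgood, ?_⟩)
      have hle : j ⟨i, hiM⟩ ≤ J + 1 := (hjJ ⟨i, hiM⟩).trans (Nat.le_succ J)
      exact Curve.HasTraversals.of_le htrav hle
    · left
      -- a passage point of a traversing strand: within `η` of the net point
      obtain ⟨sP, tP, hst, -⟩ := htrav
      obtain ⟨t, ht⟩ : ∃ t : I,
          dist ((⟨γ.walk.toCurve (meshPoint δ)⟩ : Curve ℂ) t) (N i) ≤ η := by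
        rcases (hst 0).2 with ⟨h, -⟩ | ⟨-, h⟩
        · exact ⟨sP 0, h⟩
        · exact ⟨tP 0, h⟩
      -- a point of the complement within `2R'` of the net point
      obtain ⟨q, hq, hqD⟩ := Set.not_subset.1 hgood
      rw [mem_closedBall] at hq
      refine ⟨t, ?_, ?_, ?_⟩
      · have h1 := hfar (D.pt 0) i hfa
        have h2 := dist_triangle (N i) ((⟨γ.walk.toCurve (meshPoint δ)⟩ : Curve ℂ) t) (D.pt 0)
        rw [dist_comm] at ht
        linarith
      · have h1 := hfar (D.pt 1) i hfb
        have h2 := dist_triangle (N i) ((⟨γ.walk.toCurve (meshPoint δ)⟩ : Curve ℂ) t) (D.pt 1)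
        rw [dist_comm] at ht
        linarith
      · calc Metric.infDist ((⟨γ.walk.toCurve (meshPoint δ)⟩ : Curve ℂ) t) D.carrierᶜ
            ≤ dist ((⟨γ.walk.toCurve (meshPoint δ)⟩ : Curve ℂ) t) q := Metric.infDist_le_dist_of_mem hqD
          _ ≤ dist ((⟨γ.walk.toCurve (meshPoint δ)⟩ : Curve ℂ) t) (N i) + dist q (N i) := by
              rw [dist_comm q (N i)]; exact dist_triangle _ _ _
          _ ≤ η + 2 * R' := add_le_add ht hq
          _ ≤ s := hηs
  have hδB' : δ ∈ Set.Ioc (0 : ℝ) δB := ⟨hδ.1, hδ.2.trans hδ₁B⟩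
  calc SAW.law D.carrier δ (a δ) (b δ) {γ : SAW.DomainSAW D.carrier δ (a δ) (b δ) |
          (⟨γ.walk.toCurve (meshPoint δ)⟩ : Curve ℂ).HasTraversals (M * J + 1) x ρ R}
      ≤ SAW.law D.carrier δ (a δ) (b δ)
          ({γ | ∃ t : I, d ≤ dist ((⟨γ.walk.toCurve (meshPoint δ)⟩ : Curve ℂ) t) (D.pt 0) ∧
              d ≤ dist ((⟨γ.walk.toCurve (meshPoint δ)⟩ : Curve ℂ) t) (D.pt 1) ∧
              Metric.infDist ((⟨γ.walk.toCurve (meshPoint δ)⟩ : Curve ℂ) t) D.carrierᶜ ≤ s} ∪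
          ⋃ i : Fin M, {γ | closedBall (N i) (2 * R') ⊆ D.carrier ∧
              (⟨γ.walk.toCurve (meshPoint δ)⟩ : Curve ℂ).HasTraversals (j i) (N i) η R'}) :=
        measure_mono hsubev
    _ ≤ SAW.law D.carrier δ (a δ) (b δ)
          {γ | ∃ t : I, d ≤ dist ((⟨γ.walk.toCurve (meshPoint δ)⟩ : Curve ℂ) t) (D.pt 0) ∧
              d ≤ dist ((⟨γ.walk.toCurve (meshPoint δ)⟩ : Curve ℂ) t) (D.pt 1) ∧
              Metric.infDist ((⟨γ.walk.toCurve (meshPoint δ)⟩ : Curve ℂ) t) D.carrierᶜ ≤ s} +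
        SAW.law D.carrier δ (a δ) (b δ)
          (⋃ i : Fin M, {γ | closedBall (N i) (2 * R') ⊆ D.carrier ∧
              (⟨γ.walk.toCurve (meshPoint δ)⟩ : Curve ℂ).HasTraversals (j i) (N i) η R'}) :=
        measure_union_le _ _
    _ ≤ ENNReal.ofReal (ε / 2) + ∑ i : Fin M, SAW.law D.carrier δ (a δ) (b δ)
          {γ | closedBall (N i) (2 * R') ⊆ D.carrier ∧
              (⟨γ.walk.toCurve (meshPoint δ)⟩ : Curve ℂ).HasTraversals (j i) (N i) η R'} :=
        add_le_add (hcollar δ hδB') (measure_iUnion_fintype_le _ _)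
    _ ≤ ENNReal.ofReal (ε / 2) + ∑ _i : Fin M, ENNReal.ofReal ε' :=
        add_le_add le_rfl (Finset.sum_le_sum fun i _ => hbound i δ ⟨hδ.1, hδ.2.trans (hδ₁le i)⟩)
    _ = ENNReal.ofReal (ε / 2) + ENNReal.ofReal (M * ε') := by
        rw [Finset.sum_const, Finset.card_univ, Fintype.card_fin, nsmul_eq_mul,
          ENNReal.ofReal_mul (Nat.cast_nonneg M), ENNReal.ofReal_natCast]
    _ = ENNReal.ofReal ε := by
        rw [← ENNReal.ofReal_add (by positivity) (by positivity)]
        congr 1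
        rw [hε'_def]
        field_simp
        ring

/-- **`ShellCrossingBound` from BR and bulk tightness** (the AB dress: `shellCrossing_of_perShellDecay`, p107371).
[cite: AizenmanBurchardDuke1999, §1.b and Lemma 3.1] -/
theorem shellCrossingBound_of_boundaryRepulsion_of_bulkShellTight
    (hBR : ∀ (D : DobrushinDomain) (a b : ℝ → Site 2), SAW.IsEndpointApprox D a b →
      ∀ d : ℝ, 0 < d → ∀ ε : ℝ, 0 < ε → ∃ (s δ₁ : ℝ), 0 < s ∧ 0 < δ₁ ∧ ∀ δ ∈ Set.Ioc (0 : ℝ) δ₁,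
        SAW.law D.carrier δ (a δ) (b δ)
          {γ | ∃ t : I, d ≤ dist ((⟨γ.walk.toCurve (meshPoint δ)⟩ : Curve ℂ) t) (D.pt 0) ∧
                d ≤ dist ((⟨γ.walk.toCurve (meshPoint δ)⟩ : Curve ℂ) t) (D.pt 1) ∧
                Metric.infDist ((⟨γ.walk.toCurve (meshPoint δ)⟩ : Curve ℂ) t) D.carrierᶜ ≤ s} ≤
          ENNReal.ofReal ε)
    (hB : ∀ (D : DobrushinDomain) (a b : ℝ → Site 2), SAW.IsEndpointApprox D a b →
      ∀ (y : ℂ) (η R : ℝ), 0 < η → η < R → Metric.closedBall y (2 * R) ⊆ D.carrier →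
        ∀ ε : ℝ, 0 < ε → ∃ (j : ℕ) (δ₁ : ℝ), 0 < δ₁ ∧ ∀ δ ∈ Set.Ioc (0 : ℝ) δ₁,
          SAW.law D.carrier δ (a δ) (b δ)
            {γ | (⟨γ.walk.toCurve (meshPoint δ)⟩ : Curve ℂ).HasTraversals j y η R} ≤ ENNReal.ofReal ε) :
    Summit.CriticalPhenomena.SAWScalingLimit.Theses.SAWRenewalTightness.ShellCrossingBound :=
  fun D a b hab => shellCrossing_of_perShellDecay D a b
    (perShellDecay_of_boundaryRepulsion_of_bulkShellTight hBR hB D a b hab)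

/-! ### The composition: the crux from BR and bulk tightness -/

/-- **`EventualTight ⟸ BR ∧ BulkShellTight`** (the composition of line `boundary_repulsion` of crux stmt-CriticalPhenomena-1372):
BR and `BulkShellTight` give `ShellCrossingBound` (above) and the landed Aizenman–Burchard criterion
`Theorems.TightOfShellCrossing_proof` (item stmt-4732) closes the crux.  Neither hypothesis is asserted (both research-grade:
BR = registered stub `stub_boundaryRepulsion`, bulk = item stmt-CriticalPhenomena-17588).
[cite: AizenmanBurchardDuke1999, Thms 1.1-1.2 and Lemma 3.1] -/
theorem eventualTight_of_boundaryRepulsion_of_bulkShellTight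
    (hBR : ∀ (D : DobrushinDomain) (a b : ℝ → Site 2), SAW.IsEndpointApprox D a b →
      ∀ d : ℝ, 0 < d → ∀ ε : ℝ, 0 < ε → ∃ (s δ₁ : ℝ), 0 < s ∧ 0 < δ₁ ∧ ∀ δ ∈ Set.Ioc (0 : ℝ) δ₁,
        SAW.law D.carrier δ (a δ) (b δ)
          {γ | ∃ t : I, d ≤ dist ((⟨γ.walk.toCurve (meshPoint δ)⟩ : Curve ℂ) t) (D.pt 0) ∧
                d ≤ dist ((⟨γ.walk.toCurve (meshPoint δ)⟩ : Curve ℂ) t) (D.pt 1) ∧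
                Metric.infDist ((⟨γ.walk.toCurve (meshPoint δ)⟩ : Curve ℂ) t) D.carrierᶜ ≤ s} ≤
          ENNReal.ofReal ε)
    (hB : ∀ (D : DobrushinDomain) (a b : ℝ → Site 2), SAW.IsEndpointApprox D a b →
      ∀ (y : ℂ) (η R : ℝ), 0 < η → η < R → Metric.closedBall y (2 * R) ⊆ D.carrier →
        ∀ ε : ℝ, 0 < ε → ∃ (j : ℕ) (δ₁ : ℝ), 0 < δ₁ ∧ ∀ δ ∈ Set.Ioc (0 : ℝ) δ₁,
          SAW.law D.carrier δ (a δ) (b δ)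
            {γ | (⟨γ.walk.toCurve (meshPoint δ)⟩ : Curve ℂ).HasTraversals j y η R} ≤ ENNReal.ofReal ε) :
    Summit.CriticalPhenomena.SAWScalingLimit.Theses.SAWRenewalTightness.EventualTight :=
  TightOfShellCrossing_proof (shellCrossingBound_of_boundaryRepulsion_of_bulkShellTight hBR hB)

/-- **Items wiring.**  With the bulk stub discharged from the bounded-exterior virgin-arc atom X2c₁ᵇ
(item stmt-CriticalPhenomena-18042, verbatim hypothesis of `Theorems.bulkShellTight_of_virginArcTraversalTightBounded`):
`EventualTight ⟸ BR ∧ X2c₁ᵇ` — the E-free counterpart of the route glue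
`Theorems.eventualTight_of_virginArcTraversalTightBounded_of_confinementPositivity` (p151500). -/
theorem eventualTight_of_boundaryRepulsion_of_virginArcTraversalTightBounded
    (hBR : ∀ (D : DobrushinDomain) (a b : ℝ → Site 2), SAW.IsEndpointApprox D a b →
      ∀ d : ℝ, 0 < d → ∀ ε : ℝ, 0 < ε → ∃ (s δ₁ : ℝ), 0 < s ∧ 0 < δ₁ ∧ ∀ δ ∈ Set.Ioc (0 : ℝ) δ₁,
        SAW.law D.carrier δ (a δ) (b δ)
          {γ | ∃ t : I, d ≤ dist ((⟨γ.walk.toCurve (meshPoint δ)⟩ : Curve ℂ) t) (D.pt 0) ∧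
                d ≤ dist ((⟨γ.walk.toCurve (meshPoint δ)⟩ : Curve ℂ) t) (D.pt 1) ∧
                Metric.infDist ((⟨γ.walk.toCurve (meshPoint δ)⟩ : Curve ℂ) t) D.carrierᶜ ≤ s} ≤
          ENNReal.ofReal ε)
    (hX : ∀ C θ : ℝ, 0 < θ →
      ∃ (k : ℕ) (N₀ : ℝ), 0 < N₀ ∧
        ∀ (H : SimpleGraph (Site 2)) (Λ : Set (Site 2)) (z₀ : ℂ) (N : ℝ) (u c u' c' : Site 2),
          Λ.Finite → (∀ v ∈ Λ, dist (Site.toComplex v) z₀ ≤ C * N) → N₀ ≤ N →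
          (H ≤ zdGraph 2 ∧ (∀ v : Site 2, dist (Site.toComplex v) z₀ ≤ N → v ∈ Λ) ∧
            ∀ v v' : Site 2, dist (Site.toComplex v) z₀ ≤ N + 1 →
              dist (Site.toComplex v') z₀ ≤ N + 1 → (zdGraph 2).Adj v v' → H.Adj v v') →
          (H.Adj u c ∧ u ∉ Λ ∧ c ∈ Λ ∧ dist (Site.toComplex c) z₀ ≤ N ∧
            N < dist (Site.toComplex u) z₀) →
          (H.Adj u' c' ∧ u' ∉ Λ ∧ c' ∈ Λ ∧ dist (Site.toComplex c') z₀ ≤ N ∧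
            N < dist (Site.toComplex u') z₀) →
          ∑' p : {p : {p : H.Walk c c' // p.IsPath ∧ ∀ v ∈ p.support, v ∈ Λ} //
              ∃ ι κ : Fin k → Fin (p.1.support.map Site.toComplex).length, (∀ m, ι m ≤ κ m) ∧
                (∀ m, (dist ((p.1.support.map Site.toComplex).get (ι m)) z₀ ≤ 2 * N / 5 ∧
                    3 * N / 5 ≤ dist ((p.1.support.map Site.toComplex).get (κ m)) z₀) ∨
                  (3 * N / 5 ≤ dist ((p.1.support.map Site.toComplex).get (ι m)) z₀ ∧
                    dist ((p.1.support.map Site.toComplex).get (κ m)) z₀ ≤ 2 * N / 5)) ∧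
                ∀ ⦃m m'⦄, m < m' → κ m ≤ ι m'},
              ENNReal.ofReal (SAW.criticalFugacity ^ p.1.1.length) ≤
            ENNReal.ofReal θ *
              ∑' p : {p : H.Walk c c' // p.IsPath ∧ ∀ v ∈ p.support, v ∈ Λ},
                ENNReal.ofReal (SAW.criticalFugacity ^ p.1.length)) :
    Summit.CriticalPhenomena.SAWScalingLimit.Theses.SAWRenewalTightness.EventualTight :=
  eventualTight_of_boundaryRepulsion_of_bulkShellTight hBR (bulkShellTight_of_virginArcTraversalTightBounded hX)

/-! ### BR is a sufficient one-scale atom for the boundary residual `BoundaryShellTight` -/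

/-- **`BoundaryShellTight ⟸ BR ∧ BulkShellTight`.**  The exact E-free residual of the sibling line `boundary_bulk`
(`Theorems.eventualTight_iff_bulkShellTight_and_boundaryShellTight`, p172517: `EventualTight ↔ BulkShellTight ∧ B` with
`B = Theorems.TPToTraversalBound.Radial.BoundaryShellTight`, frontier-centred count tightness, also the residual of crux
stmt-10687) follows from boundary repulsion and bulk tightness: per-shell decay holds at EVERY shell. So the two alternative
lines compose — `EventualTight ⟸ BulkShellTight ∧ BR` with BR a ONE-SCALE collar event. [folklore] -/
theorem boundaryShellTight_of_boundaryRepulsion_of_bulkShellTight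
    (hBR : ∀ (D : DobrushinDomain) (a b : ℝ → Site 2), SAW.IsEndpointApprox D a b →
      ∀ d : ℝ, 0 < d → ∀ ε : ℝ, 0 < ε → ∃ (s δ₁ : ℝ), 0 < s ∧ 0 < δ₁ ∧ ∀ δ ∈ Set.Ioc (0 : ℝ) δ₁,
        SAW.law D.carrier δ (a δ) (b δ)
          {γ | ∃ t : I, d ≤ dist ((⟨γ.walk.toCurve (meshPoint δ)⟩ : Curve ℂ) t) (D.pt 0) ∧
                d ≤ dist ((⟨γ.walk.toCurve (meshPoint δ)⟩ : Curve ℂ) t) (D.pt 1) ∧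
                Metric.infDist ((⟨γ.walk.toCurve (meshPoint δ)⟩ : Curve ℂ) t) D.carrierᶜ ≤ s} ≤
          ENNReal.ofReal ε)
    (hB : ∀ (D : DobrushinDomain) (a b : ℝ → Site 2), SAW.IsEndpointApprox D a b →
      ∀ (y : ℂ) (η R : ℝ), 0 < η → η < R → Metric.closedBall y (2 * R) ⊆ D.carrier →
        ∀ ε : ℝ, 0 < ε → ∃ (j : ℕ) (δ₁ : ℝ), 0 < δ₁ ∧ ∀ δ ∈ Set.Ioc (0 : ℝ) δ₁,
          SAW.law D.carrier δ (a δ) (b δ)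
            {γ | (⟨γ.walk.toCurve (meshPoint δ)⟩ : Curve ℂ).HasTraversals j y η R} ≤ ENNReal.ofReal ε) :
    Summit.CriticalPhenomena.SAWScalingLimit.Theorems.TPToTraversalBound.Radial.BoundaryShellTight := by
  intro D a b hab x ρ R _ hρ h4 _ ε hε
  exact perShellDecay_of_boundaryRepulsion_of_bulkShellTight hBR hB D a b hab x ρ R hρ (by linarith) ε hε

end Summit.CriticalPhenomena.SAWScalingLimit.Theorems

end
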